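import Summits.CriticalPhenomena.PercolationContinuityZ3.Theorems.SahiMasterFamilySparseEndLimit
import Summits.CriticalPhenomena.PercolationContinuityZ3.Theorems.SahiMasterFamily

/-!
# The principal-cap dichotomy for Sahi's functionals of increasing events (TYPED CONJECTURE, all orders) and its reduction to one lemma

Support file of the master-family programme (crux `NoHeavyLowerTail`, stmt-CriticalPhenomena-4575; cell `prim-masterthm`, seat P4,
unit `prim-masterthm-p4-g5`).  Seat document HOME/prim-masterthm-p4/CORNERS.md §2.

A family of increasing events `U_0,…,U_n` of a finite cube is PRINCIPAL-CAP at `c` if the configurations common to all the events are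
exactly the supersets of `c` (`⋂ U_i = ↑c`; e.g. every TIGHT family, whose cores cover the ground set, with `c = univ`).  Then `c` is
the unique minimum common configuration and the sparse-end leading coefficient of gen 4 is the single integer
`Λ(U) := Λ'(F^{(c)}) = N_{Q(c)}(𝟙) ≥ 0` (`SahiSparseEnd.LambdaSys (Fc U c) c`).

* `PCD n` — the CONJECTURE (census-exact on every cell computed, CORNERS.md §2; proved on paper for `n + 1 ≤ 3`): for a principal-cap
  family of `n + 1` increasing events, `Λ(U) = 0` forces `E_{n+1}(μ; 1_U) = 0` under EVERY product weight `spw w p`.  The converse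
  `E ≡ 0 ⇒ Λ(U) = 0` (`lambdaSys_eq_zero_of_forall_sahiE_eq_zero`) and `Λ(U) > 0 ⇒ E > 0 near p = 0`
  (`exists_pos_forall_sahiE_spw_pos_of_principalCap`) are PROVED here, so on the principal-cap class the identically-zero locus would
  be the finite criterion `N_Q(𝟙) = 0`.
* `KeyStep n` — the ONE remaining lemma (census: 0 exceptions in 13 561 instances): a principal-cap family of `n + 2` events with
  `Λ = 0` is either identically zero outright (the all-cylinder case: independent cylinders) or has a slot `i` whose deletion leaves
  a principal-cap family with `Λ = 0` (empirically, any slot with a non-principal trace does).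
* **`pcd_succ`**: `KeyStep n → PCD n → PCD (n + 1)` — PROVED: peel the slot `i` (tree `sahiE_peel`); the deleted family is
  identically zero by `PCD n`, so the `p^{|c|}`-coefficients give `Λ(U) = Σ_l Λ(V_l)` over the modified families `V_l`
  (`lambdaSys_eq_sum_peelFam`; each `V_l` principal-cap at the same `c`, each `Λ(V_l) ≥ 0`), hence every `Λ(V_l) = 0`, hence every
  `E(V_l) ≡ 0` by `PCD n`, hence `E(U) ≡ 0`.  `pcd_zero` (order 1: `Λ = 1`), **`pcd_of_keyStep`**: `(∀ n, KeyStep n) → ∀ n, PCD n`.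
HONEST FRAMING: a typed conjecture with its inductive skeleton closed modulo the named lemma `KeyStep`; it concerns the
identically-zero locus, not positivity.  Sahi `C_k` / Kahn Conj. 5 / the master theorem remain open.  [this work]
-/

namespace Summit.CriticalPhenomena.PercolationContinuityZ3.Theorems

namespace SahiSparseEnd

open Finset Filter Topology Function SahiRepresentativeForm SahiLightAtoms
open Literature.Combinatorics.Sahi2008

universe u

variable {ι : Type*} [Fintype ι] [DecidableEq ι]

/-! ### Principal-cap families -/

/-- `U` is PRINCIPAL-CAP at `c`: a configuration lies in every event iff it contains `c` (`⋂ U_i = ↑c`). [this work] -/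
def IsPrincipalCap {k : ℕ} (U : Fin k → Finset (Finset ι)) (c : Finset ι) : Prop :=
  ∀ a : Finset ι, (∀ i, a ∈ U i) ↔ c ⊆ a

section Cap

variable {n : ℕ} {U : Fin (n + 1) → Finset (Finset ι)} {c : Finset ι} (hpc : IsPrincipalCap U c)

include hpc in
/-- `c` is a common configuration. [this work] -/
theorem IsPrincipalCap.self_mem_common : c ∈ common U := (mem_common U).2 ((hpc c).2 subset_rfl)

include hpc in
/-- The minimum size of a common configuration is `|c|`. [this work] -/
theorem IsPrincipalCap.minSize_eq (h : (common U).Nonempty) : minSize U h = c.card := by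
  refine le_antisymm (minSize_le U hpc.self_mem_common) ?_
  refine le_min' _ _ _ fun m hm => ?_
  obtain ⟨a, ha, rfl⟩ := mem_image.1 hm
  exact card_le_card ((hpc a).1 ((mem_common U).1 ha))

include hpc in
/-- The only minimum common configuration is `c`. [this work] -/
theorem IsPrincipalCap.commonMin_eq (h : (common U).Nonempty) : commonMin U h = {c} := by
  ext a
  rw [commonMin, mem_filter, mem_singleton, hpc.minSize_eq h]
  constructor
  · rintro ⟨ha, hcard⟩
    exact (eq_of_subset_of_card_le ((hpc a).1 ((mem_common U).1 ha)) hcard.le).symm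
  · rintro rfl
    exact ⟨hpc.self_mem_common, rfl⟩

include hpc in
/-- `c ∈ commonMin U`. [this work] -/
theorem IsPrincipalCap.mem_commonMin (h : (common U).Nonempty) : c ∈ commonMin U h := by
  rw [hpc.commonMin_eq h]; exact mem_singleton_self c

end Cap

section Events

variable {n : ℕ} (U : Fin (n + 1) → Finset (Finset ι))
  (hU : ∀ i a a', a ∈ U i → a ⊆ a' → a' ∈ U i) (h0 : ∀ i, ∅ ∉ U i)

include hU h0 in
/-- `Λ'(F^{(c)}) ≥ 0` for every minimum common configuration `c` (the side conditions of `LambdaSys_nonneg`). [this work] -/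
theorem lambdaSys_Fc_nonneg (h : (common U).Nonempty) {c : Finset ι} (hc : c ∈ commonMin U h) :
    0 ≤ LambdaSys (Fc U c) c := by
  have hc' := mem_filter.1 hc
  have hcU : ∀ i, c ∈ U i := (mem_common U).1 hc'.1
  refine LambdaSys_nonneg (F := Fc U c) (c := c) ?_ ?_ ?_ (Nat.succ_pos n)
  · intro i a a' ha haa' ha'c
    rw [Fc, mem_filter] at ha ⊢
    exact ⟨hU i a a' ha.1 haa', ha'c⟩
  · intro a hac
    constructor
    · intro hall
      have haU : a ∈ common U := (mem_common U).2 fun i => (mem_filter.1 (hall i)).1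
      exact eq_of_subset_of_card_le hac (hc'.2 ▸ minSize_le U haU)
    · rintro rfl
      exact fun i => mem_filter.2 ⟨hcU i, subset_rfl⟩
  · intro i hi
    exact h0 i (mem_filter.1 hi).1

include hU h0 in
/-- For a principal-cap family, `Ẽ(0) = w^c · Λ(U)`. [this work] -/
theorem sparseE_zero_of_principalCap {c : Finset ι} (hpc : IsPrincipalCap U c) (w : ι → ℝ) (h : (common U).Nonempty) :
    sparseE w U (minSize U h) 0 = (∏ e ∈ c, w e) * (LambdaSys (Fc U c) c : ℝ) := by
  rw [sparseE_zero_eq U hU h0 w h, hpc.commonMin_eq h, sum_singleton]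

include hU h0 in
/-- With unit intensities, `Ẽ(0) = Λ(U)` for a principal-cap family. [this work] -/
theorem sparseE_one_zero_of_principalCap {c : Finset ι} (hpc : IsPrincipalCap U c) (h : (common U).Nonempty) :
    sparseE (fun _ => (1 : ℝ)) U (minSize U h) 0 = (LambdaSys (Fc U c) c : ℝ) := by
  rw [sparseE_zero_of_principalCap U hU h0 hpc _ h, prod_const_one, one_mul]

include hU in
/-- If `E ≡ 0` under the weights `spw w p` (all `p`), then `Ẽ(p) = 0` for all `p` (continuity at `0`). [this work] -/
theorem sparseE_eq_zero_of_forall_sahiE_eq_zero (w : ι → ℝ) (h : (common U).Nonempty)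
    (hE : ∀ p : ℝ, sahiE (spw w p) (n + 1) (fun i => setInd (U i)) = 0) (p : ℝ) : sparseE w U (minSize U h) p = 0 := by
  have hfun : (fun p : ℝ => sparseE w U (minSize U h) p) = fun _ => 0 := by
    refine Continuous.ext_on (dense_compl_singleton 0) (continuous_sparseE w U _) continuous_const fun q hq => ?_
    have hq : q ≠ 0 := hq
    have e := sahiE_spw_eq U hU w q h
    rw [hE q] at e
    exact (mul_eq_zero.1 e.symm).resolve_left (pow_ne_zero _ hq)
  exact congrFun hfun p

include hU h0 in
/-- **`E ≡ 0 ⇒ Λ(U) = 0`** for a principal-cap family (the easy direction of the dichotomy). [this work] -/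
theorem lambdaSys_eq_zero_of_forall_sahiE_eq_zero {c : Finset ι} (hpc : IsPrincipalCap U c)
    (hE : ∀ p : ℝ, sahiE (spw (fun _ => (1 : ℝ)) p) (n + 1) (fun i => setInd (U i)) = 0) : LambdaSys (Fc U c) c = 0 := by
  have e := sparseE_eq_zero_of_forall_sahiE_eq_zero U hU (fun _ => (1 : ℝ)) ⟨c, hpc.self_mem_common⟩ hE 0
  rw [sparseE_one_zero_of_principalCap U hU h0 hpc] at e
  exact_mod_cast e

include hU h0 in
/-- **`Λ(U) > 0 ⇒ E > 0` near `p = 0`** for a principal-cap family and positive intensities. [this work] -/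
theorem exists_pos_forall_sahiE_spw_pos_of_principalCap {c : Finset ι} (hpc : IsPrincipalCap U c) {w : ι → ℝ}
    (hw : ∀ e, 0 < w e) (hΛ : 0 < LambdaSys (Fc U c) c) :
    ∃ δ > 0, ∀ p : ℝ, 0 < p → p < δ → 0 < sahiE (spw w p) (n + 1) (fun i => setInd (U i)) :=
  sahiE_spw_pos_of_lambdaSys_pos U hU h0 hw ⟨c, hpc.self_mem_common⟩ (hpc.mem_commonMin _) hΛ

end Events

/-! ### The conjecture and the key lemma, typed -/

/-- **THE PRINCIPAL-CAP DICHOTOMY, order `n + 1` (CONJECTURE; proved on paper for `n + 1 ≤ 3`, census-exact on every cell computed).**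
For every principal-cap family of `n + 1` increasing events (up-closed, `∅ ∉ U_i`) with `Λ(U) = 0`, Sahi's functional vanishes under every
product weight `spw w p`. [this work] -/
def PCD (n : ℕ) : Prop :=
  ∀ (ι : Type u) [Fintype ι] [DecidableEq ι] (U : Fin (n + 1) → Finset (Finset ι)) (c : Finset ι),
    (∀ i a a', a ∈ U i → a ⊆ a' → a' ∈ U i) → (∀ i, ∅ ∉ U i) → IsPrincipalCap U c → LambdaSys (Fc U c) c = 0 →
    ∀ (w : ι → ℝ) (p : ℝ), sahiE (spw w p) (n + 1) (fun i => setInd (U i)) = 0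

/-- **THE KEY STEP, order `n + 2` (CONJECTURED LEMMA; 0 exceptions in the census).**  A principal-cap family of `n + 2` increasing
events with `Λ(U) = 0` is either identically zero outright, or has a slot `i` whose deletion leaves a principal-cap family with
`Λ = 0`. [this work] -/
def KeyStep (n : ℕ) : Prop :=
  ∀ (ι : Type u) [Fintype ι] [DecidableEq ι] (U : Fin (n + 2) → Finset (Finset ι)) (c : Finset ι),
    (∀ i a a', a ∈ U i → a ⊆ a' → a' ∈ U i) → (∀ i, ∅ ∉ U i) → IsPrincipalCap U c → LambdaSys (Fc U c) c = 0 →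
    (∀ (w : ι → ℝ) (p : ℝ), sahiE (spw w p) (n + 2) (fun i => setInd (U i)) = 0) ∨
      ∃ (i : Fin (n + 2)) (c' : Finset ι), IsPrincipalCap (fun j => U (i.succAbove j)) c' ∧
        LambdaSys (Fc (fun j => U (i.succAbove j)) c') c' = 0

/-! ### The peel at the level of leading coefficients -/

section Peel

variable {n : ℕ} (U : Fin (n + 2) → Finset (Finset ι)) (i : Fin (n + 2))

/-- The modified family `V_l`: delete slot `i` and intersect slot `l` with `U_i`. [this work] -/
def peelFam (l : Fin (n + 1)) : Fin (n + 1) → Finset (Finset ι) :=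
  update (fun j => U (i.succAbove j)) l (U (i.succAbove l) ∩ U i)

variable {U i}

omit [Fintype ι] in
/-- Members of `peelFam U i l`. [this work] -/
theorem peelFam_apply (l j : Fin (n + 1)) :
    peelFam U i l j = if j = l then U (i.succAbove l) ∩ U i else U (i.succAbove j) := by
  rw [peelFam, update_apply]

omit [Fintype ι] in
/-- `V_l` is up-closed. [this work] -/
theorem peelFam_up (hU : ∀ i a a', a ∈ U i → a ⊆ a' → a' ∈ U i) (l j : Fin (n + 1)) (a a' : Finset ι)
    (ha : a ∈ peelFam U i l j) (haa' : a ⊆ a') : a' ∈ peelFam U i l j := by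
  rw [peelFam_apply] at ha ⊢
  split_ifs at ha ⊢ with h
  · rw [mem_inter] at ha ⊢
    exact ⟨hU _ a a' ha.1 haa', hU _ a a' ha.2 haa'⟩
  · exact hU _ a a' ha haa'

omit [Fintype ι] in
/-- `∅ ∉ V_l j`. [this work] -/
theorem peelFam_empty_not_mem (h0 : ∀ i, ∅ ∉ U i) (l j : Fin (n + 1)) : ∅ ∉ peelFam U i l j := by
  rw [peelFam_apply]
  split_ifs with h
  · exact fun h' => h0 _ (mem_inter.1 h').1
  · exact h0 _

omit [Fintype ι] in
/-- `V_l` is principal-cap at the same `c`. [this work] -/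
theorem peelFam_principalCap {c : Finset ι} (hpc : IsPrincipalCap U c) (l : Fin (n + 1)) : IsPrincipalCap (peelFam U i l) c := by
  intro a
  constructor
  · intro ha
    refine (hpc a).1 fun m => ?_
    by_cases hm : m = i
    · subst hm
      have h1 := ha l
      rw [peelFam_apply, if_pos rfl, mem_inter] at h1
      exact h1.2
    · obtain ⟨j, rfl⟩ := Fin.exists_succAbove_eq hm
      have h1 := ha j
      rw [peelFam_apply] at h1
      split_ifs at h1 with hj
      · subst hj; exact (mem_inter.1 h1).1
      · exact h1
  · intro hca j
    have hall := (hpc a).2 hca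
    rw [peelFam_apply]
    split_ifs
    · exact mem_inter.2 ⟨hall _, hall _⟩
    · exact hall _

omit [Fintype ι] in
/-- The indicator form of the modification: `update (1_{U ∘ succAbove}) l (1_{U_{succAbove l}} · 1_{U_i}) = 1_{V_l}`. [this work] -/
theorem update_setInd_eq_peelFam (l : Fin (n + 1)) :
    update (fun j => setInd (U (i.succAbove j))) l (setInd (U (i.succAbove l)) * setInd (U i)) =
      fun j => setInd (peelFam U i l j) := by
  funext j
  rw [update_apply, peelFam_apply]
  split_ifs
  · rw [setInd_mul]
  · rfl

/-- **Peel with an identically-zero deleted family**: if `E_{n+1}(U_{−i}) = 0` then `E_{n+2}(U) = Σ_l E_{n+1}(V_l)`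
(tree `sahiE_peel`). [this work] -/
theorem sahiE_eq_sum_peelFam (μ : Finset ι → ℝ) (hdel : sahiE μ (n + 1) (fun j => setInd (U (i.succAbove j))) = 0) :
    sahiE μ (n + 2) (fun j => setInd (U j)) = ∑ l, sahiE μ (n + 1) (fun j => setInd (peelFam U i l j)) := by
  have e := sahiE_peel μ n (fun j => setInd (U j)) i
  beta_reduce at e
  rw [e, hdel, zero_mul, sub_zero]
  exact sum_congr rfl fun l _ => by rw [update_setInd_eq_peelFam]

/-- **The peel at the level of leading coefficients**: for a principal-cap family at `c` whose deleted family `U_{−i}` is identically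
zero under the unit-intensity product weights, `Λ(U) = Σ_l Λ(V_l)`. [this work] -/
theorem lambdaSys_eq_sum_peelFam (hU : ∀ i a a', a ∈ U i → a ⊆ a' → a' ∈ U i) (h0 : ∀ i, ∅ ∉ U i) {c : Finset ι}
    (hpc : IsPrincipalCap U c)
    (hdel : ∀ p : ℝ, sahiE (spw (fun _ => (1 : ℝ)) p) (n + 1) (fun j => setInd (U (i.succAbove j))) = 0) :
    (LambdaSys (Fc U c) c : ℝ) = ∑ l, (LambdaSys (Fc (peelFam U i l) c) c : ℝ) := by
  set w : ι → ℝ := fun _ => 1 with hw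
  have hVU : ∀ l, ∀ j a a', a ∈ peelFam U i l j → a ⊆ a' → a' ∈ peelFam U i l j := fun l => peelFam_up hU l
  have hV0 : ∀ l j, ∅ ∉ peelFam U i l j := fun l => peelFam_empty_not_mem h0 l
  have hVpc : ∀ l, IsPrincipalCap (peelFam U i l) c := fun l => peelFam_principalCap hpc l
  have hf0 : sparseE w U c.card 0 = (LambdaSys (Fc U c) c : ℝ) := by
    have h1 := sparseE_one_zero_of_principalCap U hU h0 hpc ⟨c, hpc.self_mem_common⟩
    rwa [hpc.minSize_eq] at h1
  have hg0 : ∀ l, sparseE w (peelFam U i l) c.card 0 = (LambdaSys (Fc (peelFam U i l) c) c : ℝ) := by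
    intro l
    have h1 := sparseE_one_zero_of_principalCap (peelFam U i l) (hVU l) (hV0 l) (hVpc l) ⟨c, (hVpc l).self_mem_common⟩
    rwa [(hVpc l).minSize_eq] at h1
  -- `Ẽ_U(p) = Σ_l Ẽ_{V_l}(p)` for `p ≠ 0` (peel + factorisation), hence at `p = 0` by continuity
  have hfg : (fun p : ℝ => sparseE w U c.card p) = fun p => ∑ l, sparseE w (peelFam U i l) c.card p := by
    refine Continuous.ext_on (dense_compl_singleton 0) (continuous_sparseE w U _) (by fun_prop) fun q hq => ?_
    have hq : q ≠ 0 := hq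
    have e := sahiE_eq_sum_peelFam (μ := spw w q) (hdel q)
    rw [sahiE_spw_eq U hU w q ⟨c, hpc.self_mem_common⟩, hpc.minSize_eq] at e
    have e' : ∀ l, sahiE (spw w q) (n + 1) (fun j => setInd (peelFam U i l j)) =
        q ^ c.card * sparseE w (peelFam U i l) c.card q := by
      intro l
      rw [sahiE_spw_eq (peelFam U i l) (hVU l) w q ⟨c, (hVpc l).self_mem_common⟩, (hVpc l).minSize_eq]
    simp only [e', ← mul_sum] at e
    exact mul_left_cancel₀ (pow_ne_zero c.card hq) e
  have h00 := congrFun hfg 0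
  beta_reduce at h00
  rw [hf0] at h00
  rw [h00]
  exact sum_congr rfl fun l _ => hg0 l

end Peel

/-! ### The inductive skeleton -/

omit [Fintype ι] in
/-- Order one: `Λ = 1` for a principal-cap single event, so `PCD 0` holds vacuously. [this work] -/
theorem lambdaSys_fin_one (F : Fin 1 → Finset (Finset ι)) (c : Finset ι) (hc : c ∈ F 0) : LambdaSys F c = 1 := by
  have hsys : systems F c = {fun _ => c} := by
    ext γ
    rw [mem_systems, mem_singleton]
    constructor
    · rintro ⟨-, -, hun⟩
      funext j
      rw [Subsingleton.elim j 0]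
      rw [univ_unique, Fin.default_eq_zero, singleton_biUnion] at hun
      exact hun
    · rintro rfl
      refine ⟨fun j => by rw [Subsingleton.elim j 0]; exact hc, fun _ _ => Or.inl rfl, ?_⟩
      rw [univ_unique, singleton_biUnion]
  rw [LambdaSys, hsys, sum_singleton, image_const univ_nonempty, card_singleton, prod_singleton, occ_fin_one, if_pos rfl]
  norm_num

/-- **`PCD 0`** (a single principal-cap event is never a zero family: `Λ = 1`). [this work] -/
theorem pcd_zero : PCD.{u} 0 := by
  intro ι _ _ U c _ _ hpc hΛ
  exfalso
  have hc : c ∈ Fc U c 0 := mem_filter.2 ⟨(hpc c).2 subset_rfl 0, subset_rfl⟩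
  have h1 := lambdaSys_fin_one (Fc U c) c hc
  rw [hΛ] at h1
  exact zero_ne_one h1

/-- **THE REDUCTION**: `KeyStep n → PCD n → PCD (n + 1)`. [this work] -/
theorem pcd_succ {n : ℕ} (hkey : KeyStep.{u} n) (hp : PCD.{u} n) : PCD.{u} (n + 1) := by
  intro ι _ _ U c hU h0 hpc hΛ w p
  rcases hkey ι U c hU h0 hpc hΛ with hzero | ⟨i, c', hpc', hΛ'⟩
  · exact hzero w p
  · -- the deleted family is identically zero by `PCD n`
    have hdel : ∀ (w' : ι → ℝ) (q : ℝ), sahiE (spw w' q) (n + 1) (fun j => setInd (U (i.succAbove j))) = 0 :=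
      fun w' q => hp ι (fun j => U (i.succAbove j)) c' (fun j => hU _) (fun j => h0 _) hpc' hΛ' w' q
    -- hence `Λ(U) = Σ_l Λ(V_l)`, all terms `≥ 0`, so all vanish
    have hsum := lambdaSys_eq_sum_peelFam hU h0 hpc (hdel _)
    rw [hΛ, Int.cast_zero] at hsum
    have hVU : ∀ l, ∀ j a a', a ∈ peelFam U i l j → a ⊆ a' → a' ∈ peelFam U i l j := fun l => peelFam_up hU l
    have hV0 : ∀ l j, ∅ ∉ peelFam U i l j := fun l => peelFam_empty_not_mem h0 l
    have hVpc : ∀ l, IsPrincipalCap (peelFam U i l) c := fun l => peelFam_principalCap hpc l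
    have hnn : ∀ l ∈ (univ : Finset (Fin (n + 1))), (0 : ℝ) ≤ (LambdaSys (Fc (peelFam U i l) c) c : ℝ) := fun l _ =>
      Int.cast_nonneg (lambdaSys_Fc_nonneg (peelFam U i l) (hVU l) (hV0 l) ⟨c, (hVpc l).self_mem_common⟩
        ((hVpc l).mem_commonMin _))
    have hall := (sum_eq_zero_iff_of_nonneg hnn).1 hsum.symm
    -- hence every `E(V_l) ≡ 0` by `PCD n`, and `E(U) = Σ_l E(V_l) = 0`
    rw [sahiE_eq_sum_peelFam (μ := spw w p) (hdel w p)]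
    refine sum_eq_zero fun l _ => hp ι (peelFam U i l) c (hVU l) (hV0 l) (hVpc l) ?_ w p
    exact_mod_cast hall l (mem_univ l)

/-- **`(∀ n, KeyStep n) → ∀ n, PCD n`**: the principal-cap dichotomy at every order follows from the key step at every order.
[this work] -/
theorem pcd_of_keyStep (hkey : ∀ n, KeyStep.{u} n) : ∀ n, PCD.{u} n
  | 0 => pcd_zero
  | n + 1 => pcd_succ (hkey n) (pcd_of_keyStep hkey n)

end SahiSparseEnd

end Summit.CriticalPhenomena.PercolationContinuityZ3.Theorems
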